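import Summits.MatrixMultiplication.OmegaCensus.SmallFormats.GF2OrbitSweep
import HarnessLib

/-!
# ω-census family (a), GF(2) rank floors: orbit checks assembled from per-root DFS lemmas

Cell `pub-omega` (unit `pub-omega-lit`, gen 4), topic `Summits/MatrixMultiplication/OmegaCensus` (sub-folder
`SmallFormats`). Framing (verbatim): lottery ticket; floor = certified bounds/negative ranges. HONEST FRAMING:
replay infrastructure; nothing here is progress on `ω`. PROVED, no facts.

For the larger formats (`⟨2,3,3⟩`: one DFS round with 44 198 leaves under 31 roots) a single
`decide +kernel` of `orbitCheck` (`GF2OrbitSweep.lean`) is too big for one declaration. This file splits the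
check: the Boolean SIDE CONDITIONS of every step with the running bound (`chainB`, one small `decide`), and
the DFS ROOT CHECKS one root at a time (`rootCheckB os st k`, each its own theorem in its own data file),
reassembled by `orbitCheck_of_chain`.
-/

namespace Summit.MatrixMultiplication.OmegaCensus.GF2RankLB

open Literature.Computability.AlgebraicComplexity

variable (l m n : ℕ)

/-- The side conditions of a step (everything `stepBound` tests except the DFS root checks). -/
def stepSide (os : List Orbit) (i : ℕ) (K : List ℕ) (cur : ℕ) : Step → Bool
  | .flat0 xs => flat0Check l m n K xs
  | .flat1 xs bs => flat1Check l m n K xs bs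
  | .flat2 xs cs => flat2Check l m n K xs cs
  | .look extra j P Pi Q Qi => decide (j < i) && sandB l m (kOf os j) (K ++ extra) P Pi Q Qi
  | .forced ts ws cs xs sel => forcedPre l m n K ts ws cs xs sel
  | .dfs cands target x b c table _ =>
      decide (target ≤ cur + 1) && nzB l m n K x b c && coverB l m K cands && tableOK l m os i K cands table

/-- The value a step certifies when it passes. -/
def stepVal (os : List Orbit) : Step → ℕ
  | .flat0 xs => xs.length
  | .flat1 _ bs => bs.length
  | .flat2 _ cs => cs.length
  | .look _ j _ _ _ _ => bnd os j
  | .forced ts _ _ _ sel => ts.length + sel.length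
  | .dfs _ target _ _ _ _ _ => target

/-- Number of DFS roots of a step (`0` for non-DFS steps). -/
def stepN : Step → ℕ
  | .dfs cands _ _ _ _ _ _ => cands.length
  | _ => 0

/-- The check of the `k`-th DFS root of a step (vacuous for non-DFS steps or `k` out of range). -/
def rootCheckB (os : List Orbit) : Step → ℕ → Bool
  | .dfs cands target _ _ _ table roots, k =>
      if h : k < cands.length then
        (roots ⟨k, h⟩).check (lbOf os table) target (target - 1) 1 (fun _ => ⟨k, h⟩)
      else true
  | _, _ => true

/-- All DFS root checks of a step pass. -/
def RootsOK (os : List Orbit) : Step → Prop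
  | .dfs cands target _ _ _ table roots =>
      ∀ mm : Fin cands.length, (roots mm).check (lbOf os table) target (target - 1) 1 (fun _ => mm) = true
  | _ => True

/-- Root checks of all steps of a list (positional conjunction, `True`-terminated). -/
def StepsRootsOK (os : List Orbit) : List Step → Prop
  | [] => True
  | st :: rest => RootsOK os st ∧ StepsRootsOK os rest

/-- The chain of side conditions with the running bound, ending in the claimed bound. -/
def chainB (os : List Orbit) (i : ℕ) (K : List ℕ) : ℕ → List Step → Bool
  | cur, [] => decide (bnd os i ≤ cur)
  | cur, st :: rest => stepSide l m n os i K cur st && chainB os i K (max cur (stepVal os st)) rest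

variable {l m n}

/-- `RootsOK` from the per-root Boolean checks. -/
theorem rootsOK_of_forall (os : List Orbit) (st : Step) (h : ∀ k < stepN st, rootCheckB os st k = true) :
    RootsOK os st := by
  cases st with
  | dfs cands target x b c table roots =>
    intro mm
    have := h mm.1 mm.2
    simpa [rootCheckB, mm.2] using this
  | _ => trivial

/-- Under its side conditions and root checks a step certifies exactly `stepVal`. -/
theorem stepBound_eq_of_side (os : List Orbit) (i : ℕ) (K : List ℕ) (cur : ℕ) (st : Step)
    (h1 : stepSide l m n os i K cur st = true) (h2 : RootsOK os st) :
    stepBound l m n os i K cur st = stepVal os st := by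
  cases st with
  | flat0 xs => simp [stepBound, stepVal, stepSide] at h1 ⊢; simp [h1]
  | flat1 xs bs => simp [stepBound, stepVal, stepSide] at h1 ⊢; simp [h1]
  | flat2 xs cs => simp [stepBound, stepVal, stepSide] at h1 ⊢; simp [h1]
  | look extra j P Pi Q Qi =>
    simp only [stepSide, Bool.and_eq_true, decide_eq_true_eq] at h1
    simp [stepBound, stepVal, h1]
  | forced ts ws cs xs sel => simp [stepBound, stepVal, stepSide] at h1 ⊢; simp [h1]
  | dfs cands target x b c table roots =>
    simp only [stepSide, Bool.and_eq_true, decide_eq_true_eq] at h1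
    obtain ⟨⟨⟨ht, hnz⟩, hcov⟩, htab⟩ := h1
    simp only [stepBound, stepVal]
    rw [if_pos ⟨ht, hnz, hcov, htab, h2⟩]

/-- The chain computes the fold of `orbitBound`. -/
theorem le_foldl_of_chainB (os : List Orbit) (i : ℕ) (K : List ℕ) :
    ∀ (steps : List Step) (cur : ℕ), chainB l m n os i K cur steps = true → StepsRootsOK os steps →
      bnd os i ≤ steps.foldl (fun cur st => max cur (stepBound l m n os i K cur st)) cur
  | [], cur, h, _ => by simpa [chainB] using h
  | st :: rest, cur, h, hr => by
    simp only [chainB, Bool.and_eq_true] at h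
    rw [List.foldl_cons, stepBound_eq_of_side os i K cur st h.1 hr.1]
    exact le_foldl_of_chainB os i K rest _ h.2 hr.2

/-- **Orbit check from the chain and the per-root lemmas.** -/
theorem orbitCheck_of_chain (os : List Orbit) (i : ℕ)
    (h1 : chainB l m n os i (kOf os i) 0 (os.getD i default).steps = true)
    (h2 : StepsRootsOK os (os.getD i default).steps) : orbitCheck l m n os i = true := by
  simp only [orbitCheck, orbitBound, decide_eq_true_eq]
  exact le_foldl_of_chainB os i (kOf os i) _ 0 h1 h2

end Summit.MatrixMultiplication.OmegaCensus.GF2RankLB
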